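import Mathlib
import Summits.AtomisticToContinuum.Crystallization.Theses.PhononSlackCertificates

/-!
# Route `PhononSlackCertificates`, crux `NearFieldConvexity` (stmt-AtomisticToContinuum-13958), line `Sketch`:
stub `stub_interfaceOfPairCount`

INTERFACE LEMMA from the pair count.  For an interior particle `i` and a non-member `j`,
`r = |x i − x j| > 4`; with `m = ⌊r⌋ ≥ 4` one has `r⁻⁶ ≤ m⁻⁶` and `r < m + 1 ≤ 2(m+1)`, so
`r⁻⁶ ≤ Σ_{m ≥ 4} m⁻⁶ · 𝟙[r < 2(m+1)]`; summing over pairs and using the pair count at scale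
`ℓ = m + 1` gives `Σ ≤ C⁺ #∂₄Ω · Σ_{m ≥ 4} (m+1)⁴/m⁶ ≤ 2 C⁺ #∂₄Ω` (`(m+1)⁴/m⁶ ≤ 4/(m(m+1))`,
telescoping).
-/

noncomputable section

open scoped BigOperators InnerProductSpace
open Literature.MathematicalPhysics.StatisticalMechanics Literature.Geometry.DiscreteGeometry

namespace Summit.AtomisticToContinuum.Crystallization.Theorems.PhononSlackNearFieldConvexity

/-- `(q + 1)⁵ ≤ 4 q⁵` for real `q ≥ 4`. [folklore] -/
theorem interface_pow_five_le {q : ℝ} (hq : 4 ≤ q) : (q + 1) ^ 5 ≤ 4 * q ^ 5 := by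
  have h1 : q + 1 ≤ 5 / 4 * q := by linarith
  have h0 : 0 ≤ q + 1 := by linarith
  calc (q + 1) ^ 5 ≤ (5 / 4 * q) ^ 5 := pow_le_pow_left₀ h0 h1 5
    _ = 3125 / 1024 * q ^ 5 := by ring
    _ ≤ 4 * q ^ 5 := by nlinarith [pow_nonneg (by linarith : (0 : ℝ) ≤ q) 5]

/-- The telescoping bound `Σ_{m = 4}^{M-1} (m+1)⁴/m⁶ ≤ 2 − 4/M` (`M ≥ 4`). [folklore] -/
theorem interface_sum_le (M : ℕ) (hM : 4 ≤ M) :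
    ∑ m ∈ Finset.Ico 4 M, (((m : ℝ) + 1) ^ 4 / (m : ℝ) ^ 6) ≤ 2 - 4 / (M : ℝ) := by
  induction M, hM using Nat.le_induction with
  | base => norm_num
  | succ M hM ih =>
    rw [Finset.sum_Ico_succ_top hM]
    have hq : (4 : ℝ) ≤ M := by exact_mod_cast hM
    have hq0 : (0 : ℝ) < M := by linarith
    have hstep : (((M : ℕ) : ℝ) + 1) ^ 4 / ((M : ℕ) : ℝ) ^ 6 ≤ 4 / (M : ℝ) - 4 / ((M : ℝ) + 1) := by
      have h5 := interface_pow_five_le hq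
      rw [div_sub_div _ _ hq0.ne' (by linarith), div_le_div_iff₀ (by positivity) (by positivity)]
      nlinarith [pow_pos hq0 5, pow_pos hq0 6]
    push_cast
    linarith

/-- Termwise dyadic-free bound: for `r > 4` and `M > ⌊r⌋`,
`r⁻⁶ ≤ Σ_{m ∈ [4, M)} m⁻⁶ · 𝟙[r < m + 1]`. [folklore] -/
theorem interface_term_le {r : ℝ} (hr : 4 < r) {M : ℕ} (hM : ⌊r⌋₊ < M) :
    r⁻¹ ^ 6 ≤ ∑ m ∈ Finset.Ico 4 M, ((m : ℝ)⁻¹ ^ 6 * if r < (m : ℝ) + 1 then 1 else 0) := by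
  have hr0 : 0 ≤ r := by linarith
  set m₀ : ℕ := ⌊r⌋₊ with hm₀
  have hm₀le : (m₀ : ℝ) ≤ r := Nat.floor_le hr0
  have hm₀lt : r < (m₀ : ℝ) + 1 := Nat.lt_floor_add_one r
  have hm₀4 : 4 ≤ m₀ := Nat.le_floor (by norm_num; linarith)
  have hmem : m₀ ∈ Finset.Ico 4 M := Finset.mem_Ico.2 ⟨hm₀4, hM⟩
  have hm₀pos : (0 : ℝ) < m₀ := by exact_mod_cast (show 0 < m₀ by omega)
  have hsingle : r⁻¹ ^ 6 ≤ (m₀ : ℝ)⁻¹ ^ 6 * if r < (m₀ : ℝ) + 1 then 1 else 0 := by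
    rw [if_pos hm₀lt, mul_one]
    exact pow_le_pow_left₀ (inv_nonneg.2 hr0) (by rw [inv_le_inv₀ (by linarith) hm₀pos]; exact hm₀le) 6
  exact hsingle.trans (Finset.single_le_sum
    (f := fun m : ℕ => ((m : ℝ)⁻¹ ^ 6 * if r < (m : ℝ) + 1 then 1 else 0))
    (fun m _ => by positivity) hmem)

/-- **Stub (geometry): INTERFACE LEMMA from the pair count** (dyadic summation: with `ℓ_k = 4·2^k`,
`r⁻⁶ ≤ Σ_k ℓ_k⁻⁶ 𝟙[r < 2ℓ_k]` for `r ≥ 4`, and `Σ_k ℓ_k⁻⁶ · C ℓ_k⁴ = C/12`). -/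
theorem stub_interfaceOfPairCount
    (hPC : ∀ δ : ℝ, 0 < δ → ∃ C : ℝ, ∀ (N : ℕ) (x : Fin N → EuclideanSpace ℝ (Fin 3)),
      (∀ i j : Fin N, i ≠ j → δ ≤ dist (x i) (x j)) →
      ∀ Ω : Finset (Fin N), (∀ i ∈ Ω, IsTwoShellGood (1 / 20) (47 / 50) 1 x i) →
      ∀ ℓ : ℝ, 4 ≤ ℓ →
        (∑ i ∈ Ω.filter (fun i => ∀ j : Fin N, dist (x j) (x i) ≤ 4 → j ∈ Ω),
            ((Finset.univ.filter (fun j => j ∉ Ω ∧ dist (x i) (x j) < 2 * ℓ)).card : ℝ)) ≤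
          C * ℓ ^ 4 * (Nat.card {i : Fin N // i ∈ Ω ∧ ∃ j : Fin N, j ∉ Ω ∧ dist (x j) (x i) ≤ 4} : ℝ)) :
∀ δ : ℝ, 0 < δ → ∃ K : ℝ, ∀ (N : ℕ) (x : Fin N → EuclideanSpace ℝ (Fin 3)),
      (∀ i j : Fin N, i ≠ j → δ ≤ dist (x i) (x j)) →
      ∀ Ω : Finset (Fin N), (∀ i ∈ Ω, IsTwoShellGood (1 / 20) (47 / 50) 1 x i) →
        (∑ i ∈ Ω.filter (fun i => ∀ j : Fin N, dist (x j) (x i) ≤ 4 → j ∈ Ω),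
            ∑ j ∈ Finset.univ.filter (fun j => j ∉ Ω), (dist (x i) (x j))⁻¹ ^ 6) ≤
          K * (Nat.card {i : Fin N // i ∈ Ω ∧ ∃ j : Fin N, j ∉ Ω ∧ dist (x j) (x i) ≤ 4} : ℝ) := by
  intro δ hδ
  obtain ⟨C, hC⟩ := hPC δ hδ
  refine ⟨2 * max C 0, fun N x hsep Ω hΩ => ?_⟩
  classical
  set A : Finset (Fin N) := Ω.filter (fun i => ∀ j : Fin N, dist (x j) (x i) ≤ 4 → j ∈ Ω) with hA
  set E : Finset (Fin N) := Finset.univ.filter (fun j => j ∉ Ω) with hE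
  set G : ℝ := (Nat.card {i : Fin N // i ∈ Ω ∧ ∃ j : Fin N, j ∉ Ω ∧ dist (x j) (x i) ≤ 4} : ℝ)
    with hG
  have hG0 : 0 ≤ G := by rw [hG]; exact Nat.cast_nonneg _
  set C' : ℝ := max C 0 with hC'
  have hC'0 : 0 ≤ C' := le_max_right _ _
  -- pair count with the nonnegative constant `C'`
  have hPC' : ∀ ℓ : ℝ, 4 ≤ ℓ →
      (∑ i ∈ A, ((Finset.univ.filter (fun j => j ∉ Ω ∧ dist (x i) (x j) < 2 * ℓ)).card : ℝ)) ≤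
        C' * ℓ ^ 4 * G := by
    intro ℓ hℓ
    refine (hC N x hsep Ω hΩ ℓ hℓ).trans ?_
    exact mul_le_mul_of_nonneg_right (mul_le_mul_of_nonneg_right (le_max_left _ _) (by positivity))
      hG0
  -- far pairs: `4 < dist` between an interior particle and a non-member
  have hfar : ∀ i ∈ A, ∀ j ∈ E, 4 < dist (x i) (x j) := by
    intro i hi j hj
    by_contra h
    have hij := (Finset.mem_filter.1 hi).2 j (by rw [dist_comm]; exact not_lt.1 h)
    exact (Finset.mem_filter.1 hj).2 hij
  -- a uniform cap on the integer parts of the distances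
  set M : ℕ := (∑ i, ∑ j, ⌊dist (x i) (x j)⌋₊) + 5 with hM
  have hM4 : 4 ≤ M := by omega
  have hMgt : ∀ i j : Fin N, ⌊dist (x i) (x j)⌋₊ < M := by
    intro i j
    have h1 : ⌊dist (x i) (x j)⌋₊ ≤ ∑ j', ⌊dist (x i) (x j')⌋₊ :=
      Finset.single_le_sum (f := fun j' => ⌊dist (x i) (x j')⌋₊) (fun _ _ => Nat.zero_le _)
        (Finset.mem_univ j)
    have h2 : ∑ j', ⌊dist (x i) (x j')⌋₊ ≤ ∑ i', ∑ j', ⌊dist (x i') (x j')⌋₊ :=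
      Finset.single_le_sum (f := fun i' => ∑ j', ⌊dist (x i') (x j')⌋₊)
        (fun _ _ => Finset.sum_nonneg fun _ _ => Nat.zero_le _) (Finset.mem_univ i)
    omega
  -- termwise bound and swap of sums
  have hterm : ∀ i ∈ A, ∀ j ∈ E, (dist (x i) (x j))⁻¹ ^ 6 ≤
      ∑ m ∈ Finset.Ico 4 M, ((m : ℝ)⁻¹ ^ 6 * if dist (x i) (x j) < (m : ℝ) + 1 then 1 else 0) :=
    fun i hi j hj => interface_term_le (hfar i hi j hj) (hMgt i j)
  have hstep1 : ∑ i ∈ A, ∑ j ∈ E, (dist (x i) (x j))⁻¹ ^ 6 ≤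
      ∑ i ∈ A, ∑ j ∈ E, ∑ m ∈ Finset.Ico 4 M,
        ((m : ℝ)⁻¹ ^ 6 * if dist (x i) (x j) < (m : ℝ) + 1 then 1 else 0) :=
    Finset.sum_le_sum fun i hi => Finset.sum_le_sum fun j hj => hterm i hi j hj
  have hswap : ∑ i ∈ A, ∑ j ∈ E, ∑ m ∈ Finset.Ico 4 M,
        ((m : ℝ)⁻¹ ^ 6 * if dist (x i) (x j) < (m : ℝ) + 1 then 1 else 0) =
      ∑ m ∈ Finset.Ico 4 M, (m : ℝ)⁻¹ ^ 6 *
        ∑ i ∈ A, ∑ j ∈ E, (if dist (x i) (x j) < (m : ℝ) + 1 then (1 : ℝ) else 0) := by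
    have hin : ∀ i : Fin N, ∑ j ∈ E, ∑ m ∈ Finset.Ico 4 M,
        ((m : ℝ)⁻¹ ^ 6 * if dist (x i) (x j) < (m : ℝ) + 1 then 1 else 0) =
        ∑ m ∈ Finset.Ico 4 M, ∑ j ∈ E,
          ((m : ℝ)⁻¹ ^ 6 * if dist (x i) (x j) < (m : ℝ) + 1 then 1 else 0) :=
      fun i => Finset.sum_comm
    rw [Finset.sum_congr rfl fun i _ => hin i, Finset.sum_comm]
    refine Finset.sum_congr rfl fun m _ => ?_
    rw [Finset.mul_sum]
    refine Finset.sum_congr rfl fun i _ => ?_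
    rw [Finset.mul_sum]
  -- inner count at scale `m + 1`
  have hinner : ∀ m ∈ Finset.Ico 4 M,
      ∑ i ∈ A, ∑ j ∈ E, (if dist (x i) (x j) < (m : ℝ) + 1 then (1 : ℝ) else 0) ≤
        C' * ((m : ℝ) + 1) ^ 4 * G := by
    intro m hm
    have hm4 : (4 : ℝ) ≤ m := by exact_mod_cast (Finset.mem_Ico.1 hm).1
    refine le_trans ?_ (hPC' ((m : ℝ) + 1) (by linarith))
    refine Finset.sum_le_sum fun i _ => ?_
    rw [Finset.sum_boole]
    have hsub : E.filter (fun j => dist (x i) (x j) < (m : ℝ) + 1) ⊆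
        Finset.univ.filter (fun j => j ∉ Ω ∧ dist (x i) (x j) < 2 * ((m : ℝ) + 1)) := by
      intro j hj
      rw [Finset.mem_filter] at hj ⊢
      refine ⟨Finset.mem_univ j, (Finset.mem_filter.1 hj.1).2, ?_⟩
      linarith [hj.2, dist_nonneg (x := x i) (y := x j)]
    exact_mod_cast Finset.card_le_card hsub
  -- assemble
  calc ∑ i ∈ A, ∑ j ∈ E, (dist (x i) (x j))⁻¹ ^ 6
      ≤ ∑ m ∈ Finset.Ico 4 M, (m : ℝ)⁻¹ ^ 6 *
          ∑ i ∈ A, ∑ j ∈ E, (if dist (x i) (x j) < (m : ℝ) + 1 then (1 : ℝ) else 0) := by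
        rw [← hswap]; exact hstep1
    _ ≤ ∑ m ∈ Finset.Ico 4 M, (m : ℝ)⁻¹ ^ 6 * (C' * ((m : ℝ) + 1) ^ 4 * G) :=
        Finset.sum_le_sum fun m hm => mul_le_mul_of_nonneg_left (hinner m hm) (by positivity)
    _ = C' * G * ∑ m ∈ Finset.Ico 4 M, (((m : ℝ) + 1) ^ 4 / (m : ℝ) ^ 6) := by
        rw [Finset.mul_sum]
        refine Finset.sum_congr rfl fun m hm => ?_
        have hm0 : (0 : ℝ) < m := by exact_mod_cast (show 0 < m from by
          have := (Finset.mem_Ico.1 hm).1; omega)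
        field_simp
    _ ≤ C' * G * 2 := by
        refine mul_le_mul_of_nonneg_left ?_ (mul_nonneg hC'0 hG0)
        have h := interface_sum_le M hM4
        have : (0 : ℝ) ≤ 4 / (M : ℝ) := by positivity
        linarith
    _ = 2 * max C 0 * G := by rw [hC']; ring

end Summit.AtomisticToContinuum.Crystallization.Theorems.PhononSlackNearFieldConvexity
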